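import Summits.BirchSwinnertonDyer.BirchSwinnertonDyer.Theorems.AlignedTransportAtTwoMainConjectureOfRankZeroBSDAtTwoSexticNormRelationDescentSignFree
import Summits.BirchSwinnertonDyer.BirchSwinnertonDyer.Theorems.AlignedTransportAtTwoMainConjectureOfRankZeroBSDAtTwoResolventParity
import HarnessLib

/-!
# Route `AlignedTransportAtTwo`, crux C2 `MainConjectureOfRankZeroBSDAtTwo` (stmt-BirchSwinnertonDyer-22298):
# THE `S₃` NORM-RELATION DESCENT AT `p = 2`, SIGN-FREE — part B: the INEQUALITY `e_n(ℚ(W[2])) ≤ Σ_j e_n(ℚ(β_j)) + e_n(ℚ(√Δ_W))`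
# for BOTH signs of `Δ_W`, and its `e_n = 0` / `μ₂ = 0` corollaries on C2's whole domain

Sequel of `…SexticNormRelationDescentSignFree` (same seat bsd-line-att-p4 g29) and of g28's `…SexticNormRelationDescentMu`. HONEST FRAMING: WIDTH-5 attached
prover seat on line `birth` of the lead `bsd-line-att-p2`; `--supports` stmt-BirchSwinnertonDyer-22298, closes nothing; BSD is NOT proved; crux C2, its verdict
«blocked-on `Rank1Residual.GreenbergMuConjectureIrreducible`» and every registered stub untouched. THEOREMS ONLY.

WHAT. `W/ℚ` elliptic, no rational `2`-torsion abscissa, `Δ_W ∉ ℚ²`, `2Δ_W ∉ ℚ²` (the last is automatic for `W` globally minimal and good at `2`, part A §0);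
`T = ℚ(W[2])`, `β_j` the three roots of the `2`-division cubic, `δ = 4δ₀` (`δ² = Δ_W`). For ANY cyclotomic `ℤ₂`-extensions `κ_T, κ_j, κ_δ` of `T`, `ℚ(β_j)`,
`ℚ(δ)` (models in `ℚ̄`) and every layer `n`:

* ★ `classNumberPExp_divisionField_two_le_sum` — **`e_n(T) ≤ e_n(ℚ(β₀)) + e_n(ℚ(β₁)) + e_n(ℚ(β₂)) + e_n(ℚ(δ))`** (`e_n = ord₂ h(n-th layer)`): cell
  bsd-potss's per-layer Brauer–Kuroda inequality `classNumberPExp_restrict_le_sum_of_normRelation` ([BiasseEtAl2022] Prop. 3.7, denominator `3`) on part A's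
  sign-free `S₃` relation and sign-free `T ∩ ℚ_∞ = ℚ`, the five fixed fields identified with their models (g28 part 2 §4), `e_n(ℚ) = 0` (Iwasawa 1956, tree),
  and independence of the normalisation (`classNumberPExp_eq_of_isCyclotomic`). g28's part 2 had only the `= 0` corollary and only for `Δ_W < 0`.
* `classNumberPExp_divisionField_two_le_resolvent_of_cubic` — if the cubic towers are `2`-class-number free (the odd-branch rows: `h(ℚ(β)) = 1` + Chevalley +
  Fukuda), **`e_n(ℚ(W[2])) ≤ e_n(ℚ(√Δ_W))`** for every `n`: the sextic tower's `2`-class number is bounded by the resolvent's (exact by att-p3's Ferrero–Kida).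
* ★★ `classNumberPExp_divisionField_two_eq_resolvent_of_cubic` — EXACTNESS: cubic towers `2`-free ⟹ **`e_n(ℚ(W[2])) = e_n(ℚ(√Δ_W))` for every `n`** (`≥` by
  att-p3 g29's coprime `C₃`-descent `classNumberPExp_divisionField_two_modEq_two_resolvent`), hence `μ₂` vanishes for one tower iff for the other and
  `λ₂(ℚ(W[2])) = λ₂(ℚ(√Δ_W))` (`classicalMuVanishes_divisionField_two_iff_resolvent_of_cubic`, `classicalLambda_divisionField_two_eq_resolvent_of_cubic`).
* ★ `classNumberPExp_divisionField_two_eq_zero_of_cubic_of_resolvent_of_not_isSquare`, ★ `classicalMuVanishes_divisionField_two_of_cubic_of_resolvent_of_not_isSquare`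
  — g28's two descent theorems with `Δ_W < 0` REPLACED by `Δ_W ∉ ℚ² ∧ 2Δ_W ∉ ℚ²`;
* ★★ `classicalMuVanishes_divisionField_two_of_isOrdinaryAt` — ON C2's OWN BINDERS (`W` globally minimal, `IsOrdinaryAt W 2`, no rational `2`-torsion abscissa,
  `¬ IsSquare W.Δ`; BOTH signs of `Δ`): `μ₂ = 0` for the cyclotomic `ℤ₂`-towers of the three cubic fields and of the resolvent ⟹ `μ₂(ℚ(W[2])^{cyc}) = 0` —
  Lim's carrier / the middle field of the registered stub PFμ⁺ reached from the cubic road and the resolvent lane IN THE KERNEL on the crux's ENTIRE domain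
  (no Iwasawa 1973, no Ferrero–Washington). The remaining print step of PFμ⁺ (`ℚ(W[2]) → ℚ(W[2], i)`) is untouched. Nothing closed.

References: [BiasseEtAl2022] Prop. 3.7; [Washington1997] Thm. 10.8, §13.1, Prop. 13.22, Thm. 13.13; [NeukirchANT1999] III (1.6); [RaySujatha2021] §1; [Schettler2014] Thm. 2;
tree: part A, g28 parts 1–2, `…ResolventParity` (att-p3 g29), `ClassicalMuVanishesNormRelationTower` / `…KleinDescent` / `…FiniteDescent` (cell bsd-potss),
`ClassicalLambdaInvariant`.
-/

set_option linter.dupNamespace false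
set_option autoImplicit false

noncomputable section

open scoped Classical NumberField

namespace Summit.BirchSwinnertonDyer.BirchSwinnertonDyer.Theorems.AlignedTransportAtTwoSexticNormRelationDescentSignFreeMu

open NumberField Polynomial WeierstrassCurve IntermediateField Field
  Literature.NumberTheory.EllipticCurves Literature.NumberTheory.EllipticCurves.Greenberg1999
  Literature.NumberTheory.EllipticCurves.DokchitserDokchitser2012
  Literature.NumberTheory.EllipticCurves.ZpExtension Literature.NumberTheory.GaloisRepresentations
  Literature.NumberTheory.IwasawaTheory Literature.NumberTheory.NumberFields
  Summit.BirchSwinnertonDyer.BirchSwinnertonDyer.Theorems.AlignedTransportAtTwoFineRoad.DivisionCubic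
  Summit.BirchSwinnertonDyer.BirchSwinnertonDyer.Theorems.AlignedTransportAtTwoFineRoad.TowerImageDelta
  Summit.BirchSwinnertonDyer.BirchSwinnertonDyer.Theorems.AlignedTransportAtTwoCubicClosureParity
  Summit.BirchSwinnertonDyer.BirchSwinnertonDyer.Theorems.AlignedTransportAtTwoSexticTowerGrowth
  Summit.BirchSwinnertonDyer.BirchSwinnertonDyer.Theorems.AlignedTransportAtTwoSexticNormRelationDescent
  Summit.BirchSwinnertonDyer.BirchSwinnertonDyer.Theorems.AlignedTransportAtTwoSexticNormRelationDescentMu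
  Summit.BirchSwinnertonDyer.BirchSwinnertonDyer.Theorems.AlignedTransportAtTwoSexticNormRelationDescentSignFree
  Summit.BirchSwinnertonDyer.BirchSwinnertonDyer.Theorems.AlignedTransportAtTwoResolventParity

variable (W : WeierstrassCurve ℚ) [W.IsElliptic]

/-! ## §4′ The descent inequality, sign-free -/

/-- ★ **THE DESCENT INEQUALITY, BOTH SIGNS OF `Δ_W`.** `W/ℚ` elliptic, no rational `2`-torsion abscissa, `Δ_W ∉ ℚ²`, `2Δ_W ∉ ℚ²`; `κ_T, κ_j, κ_δ` ANY cyclotomic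
`ℤ₂`-extensions of `T = ℚ(W[2])`, of the cubic fields `ℚ(β_j) ⊆ ℚ̄` and of the resolvent `ℚ(δ) ⊆ ℚ̄`. Then for every `n`
`e_n(T) ≤ e_n(ℚ(β₀)) + e_n(ℚ(β₁)) + e_n(ℚ(β₂)) + e_n(ℚ(δ))` ([BiasseEtAl2022] Prop. 3.7 with the `S₃` relation of denominator `3`, `2 ∤ 3`; `e_n(ℚ) = 0`).
[cite: BiasseEtAl2022, Prop. 3.7] [cite: Washington1997, §13.1 and Prop. 13.22] [cite: NeukirchANT1999, Ch. III §1 Prop. (1.6) (iv)] -/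
theorem classNumberPExp_divisionField_two_le_sum (ht : ∀ x : ℚ, ¬ HasRationalTwoTorsionX W x) (hsq : ¬ IsSquare W.Δ) (h2Δ : ¬ IsSquare (2 * W.Δ))
    (κK : (j : Fin 3) → ZpExtension ↥ℚ⟮xT W two_ne_zero j⟯ 2) (hκK : ∀ j, (κK j).IsCyclotomic)
    (κk : ZpExtension ↥ℚ⟮4 * delta W two_ne_zero⟯ 2) (hκk : κk.IsCyclotomic)
    (κT : ZpExtension (W.divisionField 2) 2) (hκT : κT.IsCyclotomic) (n : ℕ) :
    classNumberPExp κT n ≤ (∑ j : Fin 3, classNumberPExp (κK j) n) + classNumberPExp κk n := by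
  haveI : NumberField (W.divisionField 2) := NumberField.mk
  haveI : IsGalois ℚ (W.divisionField 2) := W.isGalois_divisionField 2
  haveI : ∀ j : Fin 3, FiniteDimensional ℚ ↥ℚ⟮xT W two_ne_zero j⟯ := fun j ↦
    IntermediateField.adjoin.finiteDimensional ((AlgebraicClosure.isAlgebraic ℚ).isAlgebraic _).isIntegral
  haveI : ∀ j : Fin 3, NumberField ↥ℚ⟮xT W two_ne_zero j⟯ := fun j ↦ NumberField.mk
  haveI : FiniteDimensional ℚ ↥ℚ⟮4 * delta W two_ne_zero⟯ :=
    IntermediateField.adjoin.finiteDimensional ((AlgebraicClosure.isAlgebraic ℚ).isAlgebraic _).isIntegral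
  haveI : NumberField ↥ℚ⟮4 * delta W two_ne_zero⟯ := NumberField.mk
  obtain ⟨κ, hκ⟩ := exists_cyclotomicZpExtension_holds ℚ 2
  have hL := surjective_gal_restrict_of_not_isSquare W ht hsq h2Δ κ hκ
  set FAM : Fin 5 → Subgroup (W.divisionField 2 ≃ₐ[ℚ] W.divisionField 2) :=
    ![(ℚ⟮(⟨xT W two_ne_zero 0, xT_mem W 0⟩ : W.divisionField 2)⟯).fixingSubgroup,
      (ℚ⟮(⟨xT W two_ne_zero 1, xT_mem W 1⟩ : W.divisionField 2)⟯).fixingSubgroup,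
      (ℚ⟮(⟨xT W two_ne_zero 2, xT_mem W 2⟩ : W.divisionField 2)⟯).fixingSubgroup,
      (ℚ⟮(⟨4 * delta W two_ne_zero, (delta_mem_and_sq W).1⟩ : W.divisionField 2)⟯).fixingSubgroup, ⊤] with hFAM
  have hH : ∀ i, Function.Surjective (κ.toContinuousMonoidHom.comp (absGaloisRestrict ℚ ↥(fixedField (FAM i)))) :=
    fun i ↦ surjective_comp_absGaloisRestrict_of_tower κ ↥(fixedField (FAM i)) (W.divisionField 2) hL
  have hineq := classNumberPExp_restrict_le_sum_of_normRelation κ (W.divisionField 2) hL FAM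
    (![fun x => if x = 1 then (1 : ℤ) else 0, fun x => if x = 1 then (1 : ℤ) else 0,
        fun x => if x = 1 then (1 : ℤ) else 0, fun x => if x = 1 then (1 : ℤ) else 0,
        fun x => if x = 1 then (-1 : ℤ) else 0])
    (fun (_ : Fin 5) (y : W.divisionField 2 ≃ₐ[ℚ] W.divisionField 2) => if y = 1 then (1 : ℤ) else 0) (d := 3) (by decide)
    (normRelation_gal_of_not_isSquare W ht hsq) hH n
  -- identify the five terms with the given towers on the models
  have tK : ∀ j : Fin 3, ∀ (hs : Function.Surjective (κ.toContinuousMonoidHom.comp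
      (absGaloisRestrict ℚ ↥(fixedField (ℚ⟮(⟨xT W two_ne_zero j, xT_mem W j⟩ : W.divisionField 2)⟯).fixingSubgroup)))),
      classNumberPExp (κ.restrict _ hs) n = classNumberPExp (κK j) n := by
    intro j hs
    obtain ⟨φ⟩ := nonempty_algEquiv_fixedField_cubic W j
    have h' := surjective_cubic_restrict W ht κ j
    rw [classNumberPExp_restrict_eq_of_algEquiv κ φ hs h' n]
    exact classNumberPExp_eq_of_isCyclotomic _ _ (isCyclotomic_restrict κ hκ _ h') (hκK j) n
  have tC : ∀ (hs : Function.Surjective (κ.toContinuousMonoidHom.comp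
      (absGaloisRestrict ℚ ↥(fixedField (ℚ⟮(⟨4 * delta W two_ne_zero, (delta_mem_and_sq W).1⟩ : W.divisionField 2)⟯).fixingSubgroup)))),
      classNumberPExp (κ.restrict _ hs) n = classNumberPExp κk n := by
    intro hs
    obtain ⟨φ⟩ := nonempty_algEquiv_fixedField_resolvent W
    have h' := surjective_resolvent_restrict_of_not_isSquare W hsq h2Δ κ hκ
    rw [classNumberPExp_restrict_eq_of_algEquiv κ φ hs h' n]
    exact classNumberPExp_eq_of_isCyclotomic _ _ (isCyclotomic_restrict κ hκ _ h') hκk n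
  have tQ : ∀ (hs : Function.Surjective (κ.toContinuousMonoidHom.comp
      (absGaloisRestrict ℚ ↥(fixedField (⊤ : Subgroup (W.divisionField 2 ≃ₐ[ℚ] W.divisionField 2)))))),
      classNumberPExp (κ.restrict _ hs) n = 0 := by
    intro hs
    obtain ⟨φ⟩ := nonempty_algEquiv_fixedField_top W
    have h' : Function.Surjective (κ.toContinuousMonoidHom.comp (absGaloisRestrict ℚ ℚ)) :=
      surjective_comp_absGaloisRestrict_of_not_dvd_finrank κ ℚ (by rw [Module.finrank_self]; decide)
    rw [classNumberPExp_restrict_eq_of_algEquiv κ φ hs h' n]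
    exact classNumberPExp_rat_eq_zero _ n
  have e0 : classNumberPExp (κ.restrict ↥(fixedField (FAM 0)) (hH 0)) n = classNumberPExp (κK 0) n := tK 0 (hH 0)
  have e1 : classNumberPExp (κ.restrict ↥(fixedField (FAM 1)) (hH 1)) n = classNumberPExp (κK 1) n := tK 1 (hH 1)
  have e2 : classNumberPExp (κ.restrict ↥(fixedField (FAM 2)) (hH 2)) n = classNumberPExp (κK 2) n := tK 2 (hH 2)
  have e3 : classNumberPExp (κ.restrict ↥(fixedField (FAM 3)) (hH 3)) n = classNumberPExp κk n := tC (hH 3)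
  have e4 : classNumberPExp (κ.restrict ↥(fixedField (FAM 4)) (hH 4)) n = 0 := tQ (hH 4)
  have hsum : ∑ i : Fin 5, classNumberPExp (κ.restrict ↥(fixedField (FAM i)) (hH i)) n =
      (∑ j : Fin 3, classNumberPExp (κK j) n) + classNumberPExp κk n := by
    rw [Fin.sum_univ_five, e0, e1, e2, e3, e4, Fin.sum_univ_three, add_zero]
  rw [classNumberPExp_eq_of_isCyclotomic κT (κ.restrict (W.divisionField 2) hL) hκT (isCyclotomic_restrict κ hκ _ hL) n, ← hsum]
  exact hineq

/-- **If the three cubic towers are `2`-class-number free then `e_n(ℚ(W[2])) ≤ e_n(ℚ(√Δ_W))` for every `n`** (both signs of `Δ_W`): on the odd-branch rows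
(`h(ℚ(β)) = 1` kernel + Chevalley + Fukuda) the sextic tower's `2`-class number is bounded by the resolvent's, which att-p3's Ferrero–Kida theorem computes.
[cite: BiasseEtAl2022, Prop. 3.7] [cite: Washington1997, §13.1] -/
theorem classNumberPExp_divisionField_two_le_resolvent_of_cubic (ht : ∀ x : ℚ, ¬ HasRationalTwoTorsionX W x) (hsq : ¬ IsSquare W.Δ)
    (h2Δ : ¬ IsSquare (2 * W.Δ))
    (hK : ∀ j : Fin 3, ∀ κj : ZpExtension ↥ℚ⟮xT W two_ne_zero j⟯ 2, κj.IsCyclotomic → ∀ n, classNumberPExp κj n = 0)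
    (κk : ZpExtension ↥ℚ⟮4 * delta W two_ne_zero⟯ 2) (hκk : κk.IsCyclotomic)
    (κT : ZpExtension (W.divisionField 2) 2) (hκT : κT.IsCyclotomic) (n : ℕ) :
    classNumberPExp κT n ≤ classNumberPExp κk n := by
  haveI : ∀ j : Fin 3, FiniteDimensional ℚ ↥ℚ⟮xT W two_ne_zero j⟯ := fun j ↦
    IntermediateField.adjoin.finiteDimensional ((AlgebraicClosure.isAlgebraic ℚ).isAlgebraic _).isIntegral
  haveI : ∀ j : Fin 3, NumberField ↥ℚ⟮xT W two_ne_zero j⟯ := fun j ↦ NumberField.mk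
  have hex : ∀ j : Fin 3, ∃ κj : ZpExtension ↥ℚ⟮xT W two_ne_zero j⟯ 2, κj.IsCyclotomic := fun j ↦ exists_cyclotomicZpExtension_holds _ 2
  choose κK hκK using hex
  have h := classNumberPExp_divisionField_two_le_sum W ht hsq h2Δ κK hκK κk hκk κT hκT n
  have h0 : ∑ j : Fin 3, classNumberPExp (κK j) n = 0 := Finset.sum_eq_zero fun j _ ↦ hK j (κK j) (hκK j) n
  rw [h0, zero_add] at h
  exact h

/-- ★★ **EXACTNESS: if the three cubic towers are `2`-class-number free then `e_n(ℚ(W[2])) = e_n(ℚ(√Δ_W))` FOR EVERY `n`** (both signs of `Δ_W`; `κ_T`,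
`κ_δ` any cyclotomic `ℤ₂`-extensions of `ℚ(W[2])`, `ℚ(δ)`). `≤` is the descent inequality; `≥` is att-p3 g29's coprime Galois descent through the `C₃`-step
`ℚ(W[2])/ℚ(δ)` (`classNumberPExp_divisionField_two_modEq_two_resolvent`: the `2`-part of `Cl(ℚ(δ)_n)` injects). So on the odd-branch rows the `2`-class numbers of
the sextic tower ARE those of the imaginary quadratic resolvent tower, layer by layer. [cite: BiasseEtAl2022, Prop. 3.7] [cite: Washington1997, Thm. 10.8 and §13.1] -/
theorem classNumberPExp_divisionField_two_eq_resolvent_of_cubic (ht : ∀ x : ℚ, ¬ HasRationalTwoTorsionX W x) (hsq : ¬ IsSquare W.Δ)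
    (h2Δ : ¬ IsSquare (2 * W.Δ))
    (hK : ∀ j : Fin 3, ∀ κj : ZpExtension ↥ℚ⟮xT W two_ne_zero j⟯ 2, κj.IsCyclotomic → ∀ n, classNumberPExp κj n = 0)
    (κk : ZpExtension ↥ℚ⟮4 * delta W two_ne_zero⟯ 2) (hκk : κk.IsCyclotomic)
    (κT : ZpExtension (W.divisionField 2) 2) (hκT : κT.IsCyclotomic) (n : ℕ) :
    classNumberPExp κT n = classNumberPExp κk n :=
  le_antisymm (classNumberPExp_divisionField_two_le_resolvent_of_cubic W ht hsq h2Δ hK κk hκk κT hκT n)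
    (classNumberPExp_divisionField_two_modEq_two_resolvent W hsq (delta_mem_and_sq W).2 κk hκk κT hκT n).2

/-- Hence (cubic towers `2`-free) **`μ₂(ℚ(W[2])^{cyc}) = 0 ⟺ μ₂(ℚ(√Δ_W)^{cyc}) = 0`** in the growth form — the two towers have the same `e_n`.
[cite: Washington1997, §13.3 Thm. 13.13] [cite: RaySujatha2021, §1 eq. (1.1)] -/
theorem classicalMuVanishes_divisionField_two_iff_resolvent_of_cubic (ht : ∀ x : ℚ, ¬ HasRationalTwoTorsionX W x) (hsq : ¬ IsSquare W.Δ)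
    (h2Δ : ¬ IsSquare (2 * W.Δ))
    (hK : ∀ j : Fin 3, ∀ κj : ZpExtension ↥ℚ⟮xT W two_ne_zero j⟯ 2, κj.IsCyclotomic → ∀ n, classNumberPExp κj n = 0)
    (κk : ZpExtension ↥ℚ⟮4 * delta W two_ne_zero⟯ 2) (hκk : κk.IsCyclotomic)
    (κT : ZpExtension (W.divisionField 2) 2) (hκT : κT.IsCyclotomic) : ClassicalMuVanishes κT ↔ ClassicalMuVanishes κk := by
  have h := fun n ↦ classNumberPExp_divisionField_two_eq_resolvent_of_cubic W ht hsq h2Δ hK κk hκk κT hκT n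
  simp only [classicalMuVanishes_iff, h]

/-- Hence (cubic towers `2`-free) **`λ₂(ℚ(W[2])) = λ₂(ℚ(√Δ_W))`** (`classicalLambda`, the slope of the growth law; equal junk values `0` when `μ ≠ 0`): on the
odd-branch rows the sextic `λ₂` IS Ferrero–Kida's `Σ_{ℓ ∣ d} 2^{ord₂(ℓ²−1)−3} − 1` of the resolvent. [cite: Washington1997, §13.3 Thm. 13.13] [cite: Schettler2014, Thm. 2] -/
theorem classicalLambda_divisionField_two_eq_resolvent_of_cubic (ht : ∀ x : ℚ, ¬ HasRationalTwoTorsionX W x) (hsq : ¬ IsSquare W.Δ)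
    (h2Δ : ¬ IsSquare (2 * W.Δ))
    (hK : ∀ j : Fin 3, ∀ κj : ZpExtension ↥ℚ⟮xT W two_ne_zero j⟯ 2, κj.IsCyclotomic → ∀ n, classNumberPExp κj n = 0)
    (κk : ZpExtension ↥ℚ⟮4 * delta W two_ne_zero⟯ 2) (hκk : κk.IsCyclotomic)
    (κT : ZpExtension (W.divisionField 2) 2) (hκT : κT.IsCyclotomic) : classicalLambda κT = classicalLambda κk := by
  have h := fun n ↦ classNumberPExp_divisionField_two_eq_resolvent_of_cubic W ht hsq h2Δ hK κk hκk κT hκT n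
  by_cases hμ : ClassicalMuVanishes κk
  · obtain ⟨ν, n₀, hg⟩ := classicalLambda_spec κk hμ
    exact (eq_classicalLambda_of_growth κT (l := classicalLambda κk) (ν := ν) (n₀ := n₀) (fun n hn ↦ by rw [h n]; exact hg n hn)).symm
  · have hμT : ¬ ClassicalMuVanishes κT := fun hT ↦ hμ
      ((classicalMuVanishes_divisionField_two_iff_resolvent_of_cubic W ht hsq h2Δ hK κk hκk κT hκT).mp hT)
    rw [classicalLambda_eq_zero_of_not_classicalMuVanishes κT hμT, classicalLambda_eq_zero_of_not_classicalMuVanishes κk hμ]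

/-- ★ **THE DESCENT, CLASS-NUMBER FORM, BOTH SIGNS OF `Δ_W`** (g28's `classNumberPExp_divisionField_two_eq_zero_of_cubic_of_resolvent` with `Δ_W < 0` replaced by
`Δ_W ∉ ℚ²`, `2Δ_W ∉ ℚ²`): `2 ∤ h` at every layer of the cyclotomic `ℤ₂`-towers of the three cubic fields and of the resolvent ⟹ `2 ∤ h(ℚ(W[2])_n)` for every `n`.
[cite: BiasseEtAl2022, Prop. 3.7] [cite: Washington1997, §13.1 and Prop. 13.22] -/
theorem classNumberPExp_divisionField_two_eq_zero_of_cubic_of_resolvent_of_not_isSquare (ht : ∀ x : ℚ, ¬ HasRationalTwoTorsionX W x)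
    (hsq : ¬ IsSquare W.Δ) (h2Δ : ¬ IsSquare (2 * W.Δ))
    (hK : ∀ j : Fin 3, ∀ κj : ZpExtension ↥ℚ⟮xT W two_ne_zero j⟯ 2, κj.IsCyclotomic → ∀ n, classNumberPExp κj n = 0)
    (hk : ∀ κk : ZpExtension ↥ℚ⟮4 * delta W two_ne_zero⟯ 2, κk.IsCyclotomic → ∀ n, classNumberPExp κk n = 0)
    (κT : ZpExtension (W.divisionField 2) 2) (hκT : κT.IsCyclotomic) (n : ℕ) :
    classNumberPExp κT n = 0 := by
  haveI : FiniteDimensional ℚ ↥ℚ⟮4 * delta W two_ne_zero⟯ :=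
    IntermediateField.adjoin.finiteDimensional ((AlgebraicClosure.isAlgebraic ℚ).isAlgebraic _).isIntegral
  haveI : NumberField ↥ℚ⟮4 * delta W two_ne_zero⟯ := NumberField.mk
  obtain ⟨κk, hκk⟩ := exists_cyclotomicZpExtension_holds ↥ℚ⟮4 * delta W two_ne_zero⟯ 2
  have h := classNumberPExp_divisionField_two_le_resolvent_of_cubic W ht hsq h2Δ hK κk hκk κT hκT n
  rw [hk κk hκk n] at h
  exact Nat.le_zero.mp h

/-- ★ **THE DESCENT, `μ`-FORM, BOTH SIGNS OF `Δ_W`** (g28's `classicalMuVanishes_divisionField_two_of_cubic_of_resolvent` with `Δ_W < 0` replaced by `Δ_W ∉ ℚ²`,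
`2Δ_W ∉ ℚ²`): `μ₂ = 0` (growth form) for the cyclotomic `ℤ₂`-towers of the cubic fields `ℚ(β_j)` and of the resolvent `ℚ(δ)` ⟹ `μ₂ = 0` for every cyclotomic
`ℤ₂`-extension of `ℚ(W[2])` (cell bsd-potss's fact-free `classicalMuVanishes_restrict_of_normRelation'` on part A's sign-free inputs).
[cite: BiasseEtAl2022, Prop. 3.7] [cite: Washington1997, §13.1] [cite: RaySujatha2021, §1 eq. (1.1)] -/
theorem classicalMuVanishes_divisionField_two_of_cubic_of_resolvent_of_not_isSquare (ht : ∀ x : ℚ, ¬ HasRationalTwoTorsionX W x)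
    (hsq : ¬ IsSquare W.Δ) (h2Δ : ¬ IsSquare (2 * W.Δ))
    (hK : ∀ j : Fin 3, ∀ κj : ZpExtension ↥ℚ⟮xT W two_ne_zero j⟯ 2, κj.IsCyclotomic → ClassicalMuVanishes κj)
    (hk : ∀ κk : ZpExtension ↥ℚ⟮4 * delta W two_ne_zero⟯ 2, κk.IsCyclotomic → ClassicalMuVanishes κk)
    (κT : ZpExtension (W.divisionField 2) 2) (hκT : κT.IsCyclotomic) : ClassicalMuVanishes κT := by
  haveI : NumberField (W.divisionField 2) := NumberField.mk
  haveI : IsGalois ℚ (W.divisionField 2) := W.isGalois_divisionField 2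
  haveI : ∀ j : Fin 3, FiniteDimensional ℚ ↥ℚ⟮xT W two_ne_zero j⟯ := fun j ↦
    IntermediateField.adjoin.finiteDimensional ((AlgebraicClosure.isAlgebraic ℚ).isAlgebraic _).isIntegral
  haveI : ∀ j : Fin 3, NumberField ↥ℚ⟮xT W two_ne_zero j⟯ := fun j ↦ NumberField.mk
  haveI : FiniteDimensional ℚ ↥ℚ⟮4 * delta W two_ne_zero⟯ :=
    IntermediateField.adjoin.finiteDimensional ((AlgebraicClosure.isAlgebraic ℚ).isAlgebraic _).isIntegral
  haveI : NumberField ↥ℚ⟮4 * delta W two_ne_zero⟯ := NumberField.mk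
  obtain ⟨κ, hκ⟩ := exists_cyclotomicZpExtension_holds ℚ 2
  have hL := surjective_gal_restrict_of_not_isSquare W ht hsq h2Δ κ hκ
  set FAM : Fin 5 → Subgroup (W.divisionField 2 ≃ₐ[ℚ] W.divisionField 2) :=
    ![(ℚ⟮(⟨xT W two_ne_zero 0, xT_mem W 0⟩ : W.divisionField 2)⟯).fixingSubgroup,
      (ℚ⟮(⟨xT W two_ne_zero 1, xT_mem W 1⟩ : W.divisionField 2)⟯).fixingSubgroup,
      (ℚ⟮(⟨xT W two_ne_zero 2, xT_mem W 2⟩ : W.divisionField 2)⟯).fixingSubgroup,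
      (ℚ⟮(⟨4 * delta W two_ne_zero, (delta_mem_and_sq W).1⟩ : W.divisionField 2)⟯).fixingSubgroup, ⊤] with hFAM
  have hH : ∀ i, Function.Surjective (κ.toContinuousMonoidHom.comp (absGaloisRestrict ℚ ↥(fixedField (FAM i)))) :=
    fun i ↦ surjective_comp_absGaloisRestrict_of_tower κ ↥(fixedField (FAM i)) (W.divisionField 2) hL
  have tK : ∀ j : Fin 3, ∀ (hs : Function.Surjective (κ.toContinuousMonoidHom.comp
      (absGaloisRestrict ℚ ↥(fixedField (ℚ⟮(⟨xT W two_ne_zero j, xT_mem W j⟩ : W.divisionField 2)⟯).fixingSubgroup)))),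
      ClassicalMuVanishes (κ.restrict _ hs) := by
    intro j hs
    obtain ⟨φ⟩ := nonempty_algEquiv_fixedField_cubic W j
    have h' := surjective_cubic_restrict W ht κ j
    rw [classicalMuVanishes_restrict_iff_of_algEquiv κ φ hs h']
    exact hK j _ (isCyclotomic_restrict κ hκ _ h')
  have tC : ∀ (hs : Function.Surjective (κ.toContinuousMonoidHom.comp
      (absGaloisRestrict ℚ ↥(fixedField (ℚ⟮(⟨4 * delta W two_ne_zero, (delta_mem_and_sq W).1⟩ : W.divisionField 2)⟯).fixingSubgroup)))),
      ClassicalMuVanishes (κ.restrict _ hs) := by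
    intro hs
    obtain ⟨φ⟩ := nonempty_algEquiv_fixedField_resolvent W
    have h' := surjective_resolvent_restrict_of_not_isSquare W hsq h2Δ κ hκ
    rw [classicalMuVanishes_restrict_iff_of_algEquiv κ φ hs h']
    exact hk _ (isCyclotomic_restrict κ hκ _ h')
  have tQ : ∀ (hs : Function.Surjective (κ.toContinuousMonoidHom.comp
      (absGaloisRestrict ℚ ↥(fixedField (⊤ : Subgroup (W.divisionField 2 ≃ₐ[ℚ] W.divisionField 2)))))),
      ClassicalMuVanishes (κ.restrict _ hs) := by
    intro hs
    obtain ⟨φ⟩ := nonempty_algEquiv_fixedField_top W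
    have h' : Function.Surjective (κ.toContinuousMonoidHom.comp (absGaloisRestrict ℚ ℚ)) :=
      surjective_comp_absGaloisRestrict_of_not_dvd_finrank κ ℚ (by rw [Module.finrank_self]; decide)
    rw [classicalMuVanishes_restrict_iff_of_algEquiv κ φ hs h']
    exact classicalMuVanishes_of_eventually_const _ (c := 0) (n₀ := 0) fun m _ => classNumberPExp_rat_eq_zero _ m
  have hμ : ∀ i, ClassicalMuVanishes (κ.restrict ↥(fixedField (FAM i)) (hH i)) := by
    intro i
    fin_cases i
    · exact tK 0 (hH 0)
    · exact tK 1 (hH 1)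
    · exact tK 2 (hH 2)
    · exact tC (hH 3)
    · exact tQ (hH 4)
  have hT := classicalMuVanishes_restrict_of_normRelation' κ (W.divisionField 2) hL FAM
    (![fun x => if x = 1 then (1 : ℤ) else 0, fun x => if x = 1 then (1 : ℤ) else 0,
        fun x => if x = 1 then (1 : ℤ) else 0, fun x => if x = 1 then (1 : ℤ) else 0,
        fun x => if x = 1 then (-1 : ℤ) else 0])
    (fun (_ : Fin 5) (y : W.divisionField 2 ≃ₐ[ℚ] W.divisionField 2) => if y = 1 then (1 : ℤ) else 0) (d := 3) (by decide)
    (normRelation_gal_of_not_isSquare W ht hsq) hH hμ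
  exact (classicalMuVanishes_iff_of_isCyclotomic _ _ (isCyclotomic_restrict κ hκ _ hL) hκT).mp hT

/-! ## §5 On C2's own binders -/

/-- ★★ **`μ₂(ℚ(W[2])^{cyc}) = 0` FROM THE CUBIC AND THE RESOLVENT, ON THE CRUX'S ENTIRE DOMAIN.** `W/ℚ` globally minimal, good ordinary at `2`, no rational
`2`-torsion abscissa, `Δ_W ∉ ℚ²` — the binders of C2 `MainConjectureOfRankZeroBSDAtTwo`, BOTH signs of `Δ_W` —: `μ₂ = 0` for the cyclotomic `ℤ₂`-towers of the
three cubic fields `ℚ(β_j)` and of the resolvent `ℚ(√Δ_W)` ⟹ `μ₂ = 0` for every cyclotomic `ℤ₂`-extension of the `S₃`-sextic `ℚ(W[2])` (Lim's carrier `E[2] ⊆ E(T)`,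
the middle field of the registered stub PFμ⁺). KERNEL (no Iwasawa 1973); `2Δ_W ∉ ℚ²` discharged by part A §0. Instance bookkeeping; nothing closed.
[cite: BiasseEtAl2022, Prop. 3.7] [cite: Washington1997, §13.1] [cite: SilvermanAEC2009, VII.5 Prop. 5.1(a)] -/
theorem classicalMuVanishes_divisionField_two_of_isOrdinaryAt [W.IsGloballyMinimal] (hord : IsOrdinaryAt W 2)
    (ht : ∀ x : ℚ, ¬ HasRationalTwoTorsionX W x) (hsq : ¬ IsSquare W.Δ)
    (hK : ∀ j : Fin 3, ∀ κj : ZpExtension ↥ℚ⟮xT W two_ne_zero j⟯ 2, κj.IsCyclotomic → ClassicalMuVanishes κj)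
    (hk : ∀ κk : ZpExtension ↥ℚ⟮4 * delta W two_ne_zero⟯ 2, κk.IsCyclotomic → ClassicalMuVanishes κk)
    (κT : ZpExtension (W.divisionField 2) 2) (hκT : κT.IsCyclotomic) : ClassicalMuVanishes κT :=
  classicalMuVanishes_divisionField_two_of_cubic_of_resolvent_of_not_isSquare W ht hsq (not_isSquare_two_mul_Δ_of_isOrdinaryAt W hord) hK hk κT hκT

/-- **`2 ∤ h(ℚ(W[2])_n)` for every `n` ON THE CRUX'S DOMAIN** from `2`-class-number-free cubic and resolvent towers (class-number form of the previous theorem).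
[cite: BiasseEtAl2022, Prop. 3.7] [cite: Washington1997, §13.1] -/
theorem classNumberPExp_divisionField_two_eq_zero_of_isOrdinaryAt [W.IsGloballyMinimal] (hord : IsOrdinaryAt W 2)
    (ht : ∀ x : ℚ, ¬ HasRationalTwoTorsionX W x) (hsq : ¬ IsSquare W.Δ)
    (hK : ∀ j : Fin 3, ∀ κj : ZpExtension ↥ℚ⟮xT W two_ne_zero j⟯ 2, κj.IsCyclotomic → ∀ n, classNumberPExp κj n = 0)
    (hk : ∀ κk : ZpExtension ↥ℚ⟮4 * delta W two_ne_zero⟯ 2, κk.IsCyclotomic → ∀ n, classNumberPExp κk n = 0)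
    (κT : ZpExtension (W.divisionField 2) 2) (hκT : κT.IsCyclotomic) (n : ℕ) : classNumberPExp κT n = 0 :=
  classNumberPExp_divisionField_two_eq_zero_of_cubic_of_resolvent_of_not_isSquare W ht hsq (not_isSquare_two_mul_Δ_of_isOrdinaryAt W hord) hK hk κT hκT n

end Summit.BirchSwinnertonDyer.BirchSwinnertonDyer.Theorems.AlignedTransportAtTwoSexticNormRelationDescentSignFreeMu

end
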